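import Literature.InformationTheory.Coding.SourcePolarizationStepMinus
import Literature.InformationTheory.Coding.SourcePolarizationStepBounds
import Literature.InformationTheory.Coding.SourcePolarizationStepRecursion
import HarnessLib

/-!
# Rough source polarization with a polynomially small unpolarized fraction (`PolarizeRough_holds`)

Theorem-only companion of `Literature/InformationTheory/Coding/SourcePolarization.lean`: the
discharge `PolarizeRough_holds` of the named fact `PolarizeRough` — there are absolute `μ > 0`, `C`
(here `μ = 1/80`, `C = 2`) such that for EVERY binary source with functional side information `g`
and every block length `t = 2^s`, at most `C · t^{1−μ}` indices `j` have
`H(U_j | U_{<j}, Y^t) ∈ (t^{-μ}, 1 − t^{-μ})` [Arıkan 2010, Thm 1 (source polarization) with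
Prop. 1–2; polynomial rate in the shape of Mondelli–Hassani–Urbanke 2016, Lemmas 5–6 /
Guruswami–Xia 2015 (rough polarization)].

## The argument (Mondelli–Hassani–Urbanke's potential-function proof, with a closed-form potential)

All one-step ingredients are the tree's: for a packaged source `S : Src` with Bhattacharyya
parameter `Z = S.zParam ∈ [0, 1]` and conditional entropy `H = S.H`, the synthetic sources satisfy
`Z(S⁺) = Z²` (`Src.zParam_plus_eq`), `Z √(2 − Z²) ≤ Z(S⁻) ≤ 2Z − Z²` (`Src.zParam_minus_ge`,
`Src.zParam_minus_le`), `Z² ≤ H ≤ log₂(1 + Z)` (`Src.sq_zParam_le_H`, `Src.H_le_logb`)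
[Arıkan 2010, Prop. 1–2; Korada–Urbanke 2010, Lemma 17], and the leakage profile obeys the tree
recursion `leak S.g (s+1) j = leak S⁻.g s j`, `leak S.g (s+1) (2^s + j) = leak S⁺.g s j`,
`leak g 0 _ = H` (`leak_succ_lo`, `leak_succ_hi`, `leak_zero`).

1. POTENTIAL.  `ψ(z) = √(z (1 − z²))` (MHU use `(z(1−z))^α` and bound the one-step ratio
   numerically; with the factor `1 − z²` and `α = 1/2` the bound is closed-form).  Plus branch:
   `ψ(z²) = √(z(1+z²)) · ψ(z)`.  Minus branch: `y ∈ [z√(2−z²), 2z − z²]` gives `y ≤ 2z − z²` and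
   `1 − y² ≤ (1 − z²)²`, so `ψ(y) ≤ √((2−z)(1−z²)) · ψ(z)`.  With `A = z(1+z²)`,
   `B = (2−z)(1−z²)`: `A + B = 2 − 2z²(1−z) ≤ 2` and `AB = (2z − z²)(1 − z⁴) ≤ 81/100` on `[0,1]`,
   hence `(√A + √B)² ≤ 2 + 2·(9/10) ≤ (39/20)²`: ONE-STEP CONTRACTION
   `ψ(Z(S⁺)) + ψ(Z(S⁻)) ≤ (39/20) ψ(Z(S))` (`psi_step_le`), i.e.
   `E[ψ(Z_{n+1}) | Z_n] ≤ (39/40) ψ(Z_n)`.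
2. LEAVES.  If `ε < H < 1 − ε` then `ψ(Z) ≥ ε/2`: `ε < log₂(1+Z)` gives
   `Z > 2^ε − 1 ≥ ε ln 2 ≥ ε/2`, and `Z² ≤ H < 1 − ε` gives `1 − Z² > ε` (`half_eps_le_psi`).
3. TREE.  By induction on `s` over all packaged sources (Markov's inequality, unrolled):
   `#{j : ε < leak S.g s j < 1 − ε} · ε/2 ≤ (39/20)^s ψ(Z(S)) ≤ (39/20)^s` (`card_window_mul_le`).
4. RATES.  With `ε = 2^{−s/80}`: count `≤ 2 (39/20)^s 2^{s/80} ≤ 2 · 2^{(1 − 1/80)s}` because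
   `(39/20) 2^{1/80} ≤ 2^{79/80}` (`(39/20)^{80} · 2 ≤ 2^{79}`).

## References

* E. Arıkan, *Source polarization*, Proc. IEEE ISIT 2010, 899–903, Thm 1, Prop. 1–2.
  bib `Arikan2010`.
* M. Mondelli, S. H. Hassani, R. Urbanke, *Unified scaling of polar codes: error exponent, scaling
  exponent, moderate deviations, and error floors*, IEEE Trans. IT 62 (2016), Lemmas 5–6.
  bib `MondelliHassaniUrbanke2016`.
* V. Guruswami, P. Xia, *Polar codes: speed of polarization and polynomial gap to capacity*, IEEE
  Trans. IT 61 (2015).  bib `GuruswamiXia2015`.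
* S. B. Korada, R. Urbanke, *Polar codes are optimal for lossy source coding*, IEEE Trans. IT 56
  (2010), Lemma 17.  bib `KoradaUrbanke2010`.
-/

noncomputable section

namespace Literature.InformationTheory.Coding.Polar

open Finset Literature.InformationTheory.Entropy

/-! ### The potential `ψ(z) = √(z (1 − z²))`: one-step contraction -/

/-- Plus branch of the potential: `ψ(z²) = √(z(1+z²)) · ψ(z)` for `z ≥ 0`. [folklore] -/
theorem sqrt_sq_mul_one_sub_eq {z : ℝ} (hz : 0 ≤ z) :
    Real.sqrt (z ^ 2 * (1 - (z ^ 2) ^ 2)) =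
      Real.sqrt (z * (1 + z ^ 2)) * Real.sqrt (z * (1 - z ^ 2)) := by
  rw [← Real.sqrt_mul (by positivity)]
  congr 1
  ring

/-- Minus branch of the potential: if `0 ≤ z ≤ 1`, `0 ≤ y ≤ 1` and `z √(2 − z²) ≤ y ≤ 2z − z²`, then
`ψ(y) ≤ √((2−z)(1−z²)) · ψ(z)` (from `y ≤ 2z − z²` and `1 − y² ≤ (1 − z²)²`). [folklore] -/
theorem sqrt_mul_one_sub_sq_le {z y : ℝ} (hz0 : 0 ≤ z) (hz1 : z ≤ 1) (hy0 : 0 ≤ y) (hy1 : y ≤ 1)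
    (hlo : z * Real.sqrt (2 - z ^ 2) ≤ y) (hhi : y ≤ 2 * z - z ^ 2) :
    Real.sqrt (y * (1 - y ^ 2)) ≤
      Real.sqrt ((2 - z) * (1 - z ^ 2)) * Real.sqrt (z * (1 - z ^ 2)) := by
  have h2z : 0 ≤ 2 - z ^ 2 := by nlinarith
  have h1z : 0 ≤ 1 - z ^ 2 := by nlinarith
  have hsq : z ^ 2 * (2 - z ^ 2) ≤ y ^ 2 := by
    calc z ^ 2 * (2 - z ^ 2) = (z * Real.sqrt (2 - z ^ 2)) ^ 2 := by
          rw [mul_pow, Real.sq_sqrt h2z]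
      _ ≤ y ^ 2 := pow_le_pow_left₀ (by positivity) hlo 2
  have h1y : 1 - y ^ 2 ≤ (1 - z ^ 2) ^ 2 := by nlinarith
  rw [← Real.sqrt_mul (mul_nonneg (by linarith) h1z)]
  apply Real.sqrt_le_sqrt
  calc y * (1 - y ^ 2) ≤ (2 * z - z ^ 2) * (1 - z ^ 2) ^ 2 :=
        mul_le_mul hhi h1y (by nlinarith) (by nlinarith)
    _ = (2 - z) * (1 - z ^ 2) * (z * (1 - z ^ 2)) := by ring

/-- The polynomial bound `AB = z(1+z²) · (2−z)(1−z²) = (2z − z²)(1 − z⁴) ≤ 81/100` on `[0, 1]`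
(true maximum `≈ 0.7313` at `z ≈ 0.595`). [folklore] -/
theorem mul_coeff_le {z : ℝ} (h0 : 0 ≤ z) (h1 : z ≤ 1) :
    z * (1 + z ^ 2) * ((2 - z) * (1 - z ^ 2)) ≤ 81 / 100 := by
  have : z * (1 + z ^ 2) * ((2 - z) * (1 - z ^ 2)) = (2 * z - z ^ 2) * (1 - z ^ 4) := by ring
  rw [this]
  nlinarith [mul_nonneg h0 (sub_nonneg.2 h1), sq_nonneg (z - 3 / 5), sq_nonneg (z ^ 2 - 9 / 25),
    mul_nonneg (mul_nonneg h0 h0) (sub_nonneg.2 h1), pow_le_one₀ h0 h1 (n := 2),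
    sq_nonneg (z ^ 3 - z), sq_nonneg (z ^ 2 - z)]

/-- The one-step coefficient bound `√(z(1+z²)) + √((2−z)(1−z²)) ≤ 39/20` on `[0, 1]`: with
`A = z(1+z²)`, `B = (2−z)(1−z²)`, `(√A + √B)² = A + B + 2√(AB) ≤ 2 + 2·(9/10) ≤ (39/20)²`.
[folklore] -/
theorem sqrt_coeff_add_sqrt_coeff_le {z : ℝ} (h0 : 0 ≤ z) (h1 : z ≤ 1) :
    Real.sqrt (z * (1 + z ^ 2)) + Real.sqrt ((2 - z) * (1 - z ^ 2)) ≤ 39 / 20 := by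
  set A := z * (1 + z ^ 2) with hA
  set B := (2 - z) * (1 - z ^ 2) with hB
  have hA0 : 0 ≤ A := by positivity
  have hB0 : 0 ≤ B := mul_nonneg (by linarith) (by nlinarith)
  have hsum : A + B ≤ 2 := by
    rw [hA, hB]
    nlinarith [mul_nonneg (sq_nonneg z) (sub_nonneg.2 h1)]
  have hprod : Real.sqrt A * Real.sqrt B ≤ 9 / 10 := by
    rw [← Real.sqrt_mul hA0, Real.sqrt_le_left (by norm_num)]
    calc A * B ≤ 81 / 100 := mul_coeff_le h0 h1
      _ = (9 / 10) ^ 2 := by norm_num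
  have hsq : (Real.sqrt A + Real.sqrt B) ^ 2 ≤ (39 / 20) ^ 2 := by
    calc (Real.sqrt A + Real.sqrt B) ^ 2 = A + B + 2 * (Real.sqrt A * Real.sqrt B) := by
          rw [add_sq, Real.sq_sqrt hA0, Real.sq_sqrt hB0]; ring
      _ ≤ 2 + 2 * (9 / 10) := by linarith
      _ ≤ (39 / 20) ^ 2 := by norm_num
  exact le_of_pow_le_pow_left₀ two_ne_zero (by norm_num) hsq

/-- **One-step contraction of the potential** `ψ(z) = √(z(1 − z²))` along Arıkan's transforms:
`ψ(Z(S⁺)) + ψ(Z(S⁻)) ≤ (39/20) · ψ(Z(S))` for every packaged binary source with functional side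
information, from `Z(S⁺) = Z²` and `Z√(2 − Z²) ≤ Z(S⁻) ≤ 2Z − Z²` alone (the shape of
Mondelli–Hassani–Urbanke's `sup_z [ψ(z²) + sup_y ψ(y)] / (2ψ(z)) < 1`).
[cite: MondelliHassaniUrbanke2016, Lemmas 5–6 (potential contraction from the one-step range)] -/
theorem psi_step_le (S : Src) :
    Real.sqrt (S.plus.zParam * (1 - S.plus.zParam ^ 2)) +
        Real.sqrt (S.minus.zParam * (1 - S.minus.zParam ^ 2)) ≤
      39 / 20 * Real.sqrt (S.zParam * (1 - S.zParam ^ 2)) := by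
  have hz0 := S.zParam_nonneg
  have hz1 := S.zParam_le_one
  rw [S.zParam_plus_eq, sqrt_sq_mul_one_sub_eq hz0]
  have hminus := sqrt_mul_one_sub_sq_le hz0 hz1 S.minus.zParam_nonneg S.minus.zParam_le_one
    S.zParam_minus_ge S.zParam_minus_le
  have hψ0 : 0 ≤ Real.sqrt (S.zParam * (1 - S.zParam ^ 2)) := Real.sqrt_nonneg _
  calc Real.sqrt (S.zParam * (1 + S.zParam ^ 2)) * Real.sqrt (S.zParam * (1 - S.zParam ^ 2)) +
          Real.sqrt (S.minus.zParam * (1 - S.minus.zParam ^ 2))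
        ≤ Real.sqrt (S.zParam * (1 + S.zParam ^ 2)) * Real.sqrt (S.zParam * (1 - S.zParam ^ 2)) +
          Real.sqrt ((2 - S.zParam) * (1 - S.zParam ^ 2)) *
            Real.sqrt (S.zParam * (1 - S.zParam ^ 2)) := by linarith
    _ = (Real.sqrt (S.zParam * (1 + S.zParam ^ 2)) +
          Real.sqrt ((2 - S.zParam) * (1 - S.zParam ^ 2))) *
            Real.sqrt (S.zParam * (1 - S.zParam ^ 2)) := by ring
    _ ≤ 39 / 20 * Real.sqrt (S.zParam * (1 - S.zParam ^ 2)) :=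
        mul_le_mul_of_nonneg_right (sqrt_coeff_add_sqrt_coeff_le hz0 hz1) hψ0

/-! ### The potential at an unpolarized leaf -/

/-- `ε log 2 ≤ 2^ε − 1` (convexity of the exponential: `1 + x ≤ e^x`). [folklore] -/
theorem mul_log_two_le_two_rpow_sub_one (ε : ℝ) : ε * Real.log 2 ≤ (2 : ℝ) ^ ε - 1 := by
  rw [Real.rpow_def_of_pos two_pos]
  have := Real.add_one_le_exp (Real.log 2 * ε)
  linarith [mul_comm ε (Real.log 2)]

/-- **The potential at an unpolarized source**: if `ε < H(S) < 1 − ε` then `ε/2 ≤ ψ(Z(S))`, because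
`H ≤ log₂(1 + Z)` forces `Z ≥ 2^ε − 1 ≥ ε ln 2 ≥ ε/2` and `Z² ≤ H` forces `1 − Z² ≥ ε`.
[cite: Arikan2010, Prop. 2 (Z² ≤ H ≤ log(1+Z): H and Z polarize simultaneously)] -/
theorem half_eps_le_psi (S : Src) {ε : ℝ} (hε : 0 < ε) (hlo : ε < S.H) (hhi : S.H < 1 - ε) :
    ε / 2 ≤ Real.sqrt (S.zParam * (1 - S.zParam ^ 2)) := by
  have hz0 := S.zParam_nonneg
  have hlogb : ε < Real.logb 2 (1 + S.zParam) := hlo.trans_le S.H_le_logb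
  have hZ : ε / 2 ≤ S.zParam := by
    have h1 : (2 : ℝ) ^ ε < 1 + S.zParam :=
      (Real.lt_logb_iff_rpow_lt one_lt_two (by linarith)).1 hlogb
    have h2 := mul_log_two_le_two_rpow_sub_one ε
    have h3 := half_lt_log_two
    nlinarith
  have hZ2 : ε ≤ 1 - S.zParam ^ 2 := by linarith [S.sq_zParam_le_H]
  rw [Real.le_sqrt (by linarith) (mul_nonneg hz0 (by linarith))]
  calc (ε / 2) ^ 2 ≤ ε / 2 * ε := by nlinarith
    _ ≤ S.zParam * (1 - S.zParam ^ 2) := mul_le_mul hZ hZ2 hε.le hz0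

/-- `ψ(Z(S)) ≤ 1`. [folklore] -/
theorem psi_le_one (S : Src) : Real.sqrt (S.zParam * (1 - S.zParam ^ 2)) ≤ 1 := by
  rw [Real.sqrt_le_left zero_le_one, one_pow]
  have hz0 := S.zParam_nonneg
  have hz1 := S.zParam_le_one
  nlinarith [sq_nonneg S.zParam]

/-! ### The tree: Markov's inequality unrolled along the recursion of the leakage profile -/

/-- The number of indices whose leakage lies in a window splits along the recursion: at level
`s + 1` for `S` it is the number at level `s` for `S⁻` plus the number at level `s` for `S⁺`.
[cite: Arikan2010, §III (recursive computation of H(U_i | U^{i-1}, Y^N))] -/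
theorem card_window_succ (S : Src) (s : ℕ) (ε : ℝ) :
    (univ.filter fun j : Fin (2 ^ (s + 1)) =>
        ε < leak S.g (s + 1) j ∧ leak S.g (s + 1) j < 1 - ε).card =
      (univ.filter fun j : Fin (2 ^ s) =>
          ε < leak S.minus.g s j ∧ leak S.minus.g s j < 1 - ε).card +
        (univ.filter fun j : Fin (2 ^ s) =>
          ε < leak S.plus.g s j ∧ leak S.plus.g s j < 1 - ε).card := by
  simp only [Finset.card_filter]
  rw [sum_univ_two_pow_succ]
  simp only [leak_succ_lo, leak_succ_hi]

/-- **Markov's inequality along the polarization tree**: for every packaged source `S`, every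
`ε > 0` and every `s`,
`#{j < 2^s : ε < H(U_j | U_{<j}, Y^t) < 1 − ε} · ε/2 ≤ (39/20)^s · ψ(Z(S))`
(induction on `s` over all sources: the recursion of the leakage profile, the one-step
contraction `psi_step_le`, and `half_eps_le_psi` at the leaves).
[cite: MondelliHassaniUrbanke2016, Lemmas 5–6 (E[(Z_n(1−Z_n))^α] decays geometrically; Markov)] -/
theorem card_window_mul_le {ε : ℝ} (hε : 0 < ε) (s : ℕ) :
    ∀ S : Src, ((univ.filter fun j : Fin (2 ^ s) =>
        ε < leak S.g s j ∧ leak S.g s j < 1 - ε).card : ℝ) * (ε / 2) ≤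
      (39 / 20) ^ s * Real.sqrt (S.zParam * (1 - S.zParam ^ 2)) := by
  induction s with
  | zero =>
    intro S
    rw [pow_zero (39 / 20 : ℝ), one_mul]
    by_cases h : ε < S.H ∧ S.H < 1 - ε
    · have hcard : ((univ.filter fun j : Fin (2 ^ 0) =>
          ε < leak S.g 0 j ∧ leak S.g 0 j < 1 - ε).card : ℝ) ≤ 1 := by
        have h1 : (univ.filter fun j : Fin (2 ^ 0) =>
            ε < leak S.g 0 j ∧ leak S.g 0 j < 1 - ε).card ≤ 1 :=
          calc _ ≤ (univ : Finset (Fin (2 ^ 0))).card := Finset.card_filter_le _ _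
            _ = 1 := by simp
        exact_mod_cast h1
      calc _ ≤ 1 * (ε / 2) := mul_le_mul_of_nonneg_right hcard (by linarith)
        _ ≤ _ := by rw [one_mul]; exact half_eps_le_psi S hε h.1 h.2
    · have hcard : (univ.filter fun j : Fin (2 ^ 0) =>
          ε < leak S.g 0 j ∧ leak S.g 0 j < 1 - ε).card = 0 := by
        rw [Finset.card_eq_zero, Finset.filter_eq_empty_iff]
        intro j _
        rw [leak_zero, ← Src.H_def]
        exact h
      rw [hcard, Nat.cast_zero, zero_mul]
      exact Real.sqrt_nonneg _
  | succ s ih =>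
    intro S
    rw [card_window_succ S s ε, Nat.cast_add, add_mul, pow_succ]
    have hm := ih S.minus
    have hp := ih S.plus
    have hstep := psi_step_le S
    have h39 : (0 : ℝ) ≤ (39 / 20) ^ s := by positivity
    calc _ ≤ (39 / 20) ^ s * Real.sqrt (S.minus.zParam * (1 - S.minus.zParam ^ 2)) +
          (39 / 20) ^ s * Real.sqrt (S.plus.zParam * (1 - S.plus.zParam ^ 2)) := add_le_add hm hp
      _ = (39 / 20) ^ s * (Real.sqrt (S.plus.zParam * (1 - S.plus.zParam ^ 2)) +
          Real.sqrt (S.minus.zParam * (1 - S.minus.zParam ^ 2))) := by ring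
      _ ≤ (39 / 20) ^ s * (39 / 20 * Real.sqrt (S.zParam * (1 - S.zParam ^ 2))) :=
          mul_le_mul_of_nonneg_left hstep h39
      _ = _ := by ring

/-! ### Rates -/

/-- The numerical heart of the rate: `(39/20) · 2^{1/80} ≤ 2^{79/80}`, i.e. `(39/40) 2^{1/40} ≤ 1`
(`80`-th powers: `(39/20)^{80} · 2 ≤ 2^{79}`). [folklore] -/
theorem rate_base_le : (39 / 20 : ℝ) * (2 : ℝ) ^ ((1 : ℝ) / 80) ≤ (2 : ℝ) ^ ((79 : ℝ) / 80) := by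
  have h80 : (80 : ℕ) ≠ 0 := by norm_num
  refine le_of_pow_le_pow_left₀ h80 (Real.rpow_nonneg zero_le_two _) ?_
  rw [mul_pow, ← Real.rpow_mul_natCast zero_le_two, ← Real.rpow_mul_natCast zero_le_two]
  norm_num

/-- The geometric bookkeeping: `(39/20)^s · 2^{s/80} ≤ 2^{(1 − 1/80) s}` for every `s`.
[folklore] -/
theorem rate_pow_le (s : ℕ) :
    (39 / 20 : ℝ) ^ s * (2 : ℝ) ^ ((1 : ℝ) / 80 * s) ≤ (2 : ℝ) ^ ((1 - (1 : ℝ) / 80) * s) := by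
  rw [Real.rpow_mul_natCast zero_le_two, Real.rpow_mul_natCast zero_le_two, ← mul_pow]
  refine pow_le_pow_left₀ (by positivity) ?_ s
  have h79 : (1 - (1 : ℝ) / 80) = 79 / 80 := by norm_num
  rw [h79]
  exact rate_base_le

/-! ### The theorem -/

/-- **Rough source polarization with a polynomially small unpolarized fraction, uniformly over
all binary sources with functional side information** (`PolarizeRough`, discharged with
`μ = 1/80`, `C = 2`): for every such source `g` and every `t = 2^s`, at most `2 · t^{79/80}`
indices `j < t` have `H(U_j | U_{<j}, Y^t) ∈ (t^{-1/80}, 1 − t^{-1/80})`.  Source polarization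
[Arıkan 2010, Thm 1] made quantitative by the Bhattacharyya supermartingale of Prop. 1
(`Z⁺ = Z²`, `Z⁻ ≤ 2Z − Z²`, here with the Korada–Urbanke lower bound `Z⁻ ≥ Z√(2−Z²)`), the
simultaneous polarization of `H` and `Z` of Prop. 2, and a Mondelli–Hassani–Urbanke potential
(`card_window_mul_le`, `rate_pow_le`).
[cite: Arikan2010, Thm 1 and Prop. 1–2 (source polarization, Bhattacharyya supermartingale)] -/
theorem PolarizeRough_holds : PolarizeRough := by
  refine ⟨1 / 80, by norm_num, 2, ?_⟩
  intro m β _ g s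
  set ε : ℝ := (2 : ℝ) ^ (-((1 : ℝ) / 80 * s)) with hε
  have hE : 0 < (2 : ℝ) ^ ((1 : ℝ) / 80 * s) := Real.rpow_pos_of_pos two_pos _
  have hε0 : 0 < ε := Real.rpow_pos_of_pos two_pos _
  have hεE : ε * (2 : ℝ) ^ ((1 : ℝ) / 80 * s) = 1 := by
    rw [hε, Real.rpow_neg zero_le_two]
    exact inv_mul_cancel₀ hE.ne'
  have key : ((univ.filter fun j : Fin (2 ^ s) => ε < leak g s j ∧ leak g s j < 1 - ε).card : ℝ) *
      (ε / 2) ≤ (39 / 20) ^ s :=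
    (card_window_mul_le hε0 s (Src.mk m β g)).trans
      (mul_le_of_le_one_right (by positivity) (psi_le_one (Src.mk m β g)))
  calc ((univ.filter fun j : Fin (2 ^ s) => ε < leak g s j ∧ leak g s j < 1 - ε).card : ℝ)
      = ((univ.filter fun j : Fin (2 ^ s) => ε < leak g s j ∧ leak g s j < 1 - ε).card : ℝ) *
          (ε / 2) * (2 * (2 : ℝ) ^ ((1 : ℝ) / 80 * s)) := by
        rw [mul_assoc, show ε / 2 * (2 * (2 : ℝ) ^ ((1 : ℝ) / 80 * s)) =
          ε * (2 : ℝ) ^ ((1 : ℝ) / 80 * s) by ring, hεE, mul_one]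
    _ ≤ (39 / 20) ^ s * (2 * (2 : ℝ) ^ ((1 : ℝ) / 80 * s)) :=
        mul_le_mul_of_nonneg_right key (by positivity)
    _ = 2 * ((39 / 20) ^ s * (2 : ℝ) ^ ((1 : ℝ) / 80 * s)) := by ring
    _ ≤ 2 * (2 : ℝ) ^ ((1 - (1 : ℝ) / 80) * s) :=
        mul_le_mul_of_nonneg_left (rate_pow_le s) zero_le_two

end Literature.InformationTheory.Coding.Polar

end
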